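import Mathlib
import HarnessLib
import Summits.ValiantsHypothesis.ValiantsHypothesis.Theorems.LacunarySymmetroidMatrixDescartesOsculationLawCuspCubicNonMonicPrelim

/-!
# ValiantsHypothesis / LacunarySymmetroid — crux `MatrixDescartes` (stmt-ValiantsHypothesis-18050, V1),
# line «osculation-law»: the NON-MONIC QUARTIC cusp curve — counting tools

For the rank-four COLUMN `(4, s)` (the count itself is successor work — see `HOME/lmr/NOTE-p6g13-osculation-rank4-and-method.md` §2):
* `fibre_four_le_gen` — ≤ 4 ordinates over each non-vertical abscissa (the quartic `a₄b⁴ + … + a₀` with not all coefficients zero at `t`),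
  abscissae positive roots of a nonzero `P`;
* `sign_of_pos_root4n`, `exists_pos_root_of_sign4n` — VIETA SIGNS for the real-rooted non-monic quartic `a₄·∏(b − μᵢ)`, `a₄ ≠ 0`: a positive
  root exists iff one of `a₃a₄, a₂a₄, a₁a₄, a₀a₄` is negative (root persistence without eigenvectors).
Twins of `OsculationCuspCubic.fibre_three_le_gen / sign_of_pos_root / exists_pos_root_of_sign` one degree up and of the monic
`OsculationCuspQuartic.fibre_four_le / sign_of_pos_root4 / exists_pos_root_of_sign4`.  No definitions, no named facts.

Honest framing: helper lemmas for a located column of an UNREGISTERED V1 law line; `OsculationLaw`, `PeelInequality`, `MatrixDescartes`,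
Conjecture B and `VP ≠ VNP` are OPEN / NOT proved.
-/

-- `Summit.ValiantsHypothesis.ValiantsHypothesis.…` is the tree's mandated single-conjunct layout (Sub = Summit).
set_option linter.dupNamespace false

noncomputable section

namespace Summit.ValiantsHypothesis.ValiantsHypothesis.Theorems.LacunarySymmetroidMatrixDescartes

open Polynomial Set
open scoped BigOperators

namespace OsculationCuspQuartic

/-! ### Fibres -/

/-- **Three ordinates per abscissa (non-monic).**  If every point `p` of `T` has `p 0 > 0` a root of the nonzero
polynomial `P`, `p 1` a root of `Ψ(p 0, ·) = a₃b³ + a₂b² + a₁b + a₀`, and `Ψ(p 0, ·)` is not the zero polynomial,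
then `#T ≤ 3·|supp P|`. [folklore] -/
theorem fibre_four_le_gen (a₄ a₃ a₂ a₁ a₀ P : ℝ[X]) (hP : P ≠ 0) (T : Set (Fin 2 → ℝ))
    (hT : ∀ p ∈ T, 0 < p 0 ∧ P.IsRoot (p 0) ∧
      a₄.eval (p 0) * p 1 ^ 4 + a₃.eval (p 0) * p 1 ^ 3 + a₂.eval (p 0) * p 1 ^ 2 + a₁.eval (p 0) * p 1 + a₀.eval (p 0) = 0 ∧
      ¬ (a₄.eval (p 0) = 0 ∧ a₃.eval (p 0) = 0 ∧ a₂.eval (p 0) = 0 ∧ a₁.eval (p 0) = 0 ∧ a₀.eval (p 0) = 0)) :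
    T.ncard ≤ 4 * P.support.card := by
  classical
  set TP : Finset ℝ := P.roots.toFinset.filter (fun t => 0 < t) with hTP
  set cub : ℝ → ℝ[X] := fun t =>
    C (a₄.eval t) * X ^ 4 + C (a₃.eval t) * X ^ 3 + C (a₂.eval t) * X ^ 2 + C (a₁.eval t) * X + C (a₀.eval t) with hcub
  have hcub_deg : ∀ t, (cub t).natDegree ≤ 4 := fun t => by
    show (C (a₄.eval t) * X ^ 4 + C (a₃.eval t) * X ^ 3 + C (a₂.eval t) * X ^ 2 + C (a₁.eval t) * X + C (a₀.eval t) :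
      ℝ[X]).natDegree ≤ 4
    refine (natDegree_add_le _ _).trans (max_le ?_ ((natDegree_C _).le.trans (Nat.zero_le _)))
    refine (natDegree_add_le _ _).trans (max_le ?_ ?_)
    · refine (natDegree_add_le _ _).trans (max_le ?_ ?_)
      · refine (natDegree_add_le _ _).trans (max_le ?_ ?_)
        · exact natDegree_C_mul_X_pow_le _ 4
        · exact natDegree_C_mul_X_pow_le _ 3 |>.trans (by norm_num)
      · exact natDegree_C_mul_X_pow_le _ 2 |>.trans (by norm_num)
    · exact (natDegree_C_mul_le _ _).trans (natDegree_X_le.trans (by norm_num))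
  set S : Finset (Fin 2 → ℝ) :=
    TP.biUnion (fun t => ((cub t).roots.toFinset).image (fun b => (![t, b] : Fin 2 → ℝ))) with hS
  have hsub : T ⊆ (S : Set (Fin 2 → ℝ)) := by
    intro p hp
    obtain ⟨htp, hroot, hΨp, hnd⟩ := hT p hp
    have hcub_ne : cub (p 0) ≠ 0 := by
      intro h0
      apply hnd
      have hc : ∀ n, (cub (p 0)).coeff n = 0 := fun n => by rw [h0, coeff_zero]
      have h4 := hc 4
      have h3 := hc 3
      have h2 := hc 2
      have h1 := hc 1
      have h00 := hc 0
      simp only [hcub, coeff_add, coeff_C_mul, coeff_X_pow, coeff_X, coeff_C] at h4 h3 h2 h1 h00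
      norm_num at h4 h3 h2 h1 h00
      exact ⟨h4, h3, h2, h1, h00⟩
    rw [Finset.mem_coe, hS, Finset.mem_biUnion]
    refine ⟨p 0, ?_, ?_⟩
    · rw [hTP, Finset.mem_filter, Multiset.mem_toFinset, mem_roots hP]
      exact ⟨hroot, htp⟩
    · rw [Finset.mem_image]
      refine ⟨p 1, ?_, ?_⟩
      · rw [Multiset.mem_toFinset, mem_roots hcub_ne, hcub, IsRoot.def]
        simp only [eval_add, eval_mul, eval_C, eval_pow, eval_X]
        linarith
      · funext i
        fin_cases i <;> rfl
  calc T.ncard ≤ (S : Set (Fin 2 → ℝ)).ncard := Set.ncard_le_ncard hsub (Finset.finite_toSet _)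
    _ = S.card := Set.ncard_coe_finset _
    _ ≤ ∑ t ∈ TP, (((cub t).roots.toFinset).image (fun b => (![t, b] : Fin 2 → ℝ))).card :=
        Finset.card_biUnion_le
    _ ≤ ∑ t ∈ TP, 4 := by
        refine Finset.sum_le_sum fun t _ => ?_
        calc _ ≤ ((cub t).roots.toFinset).card := Finset.card_image_le
          _ ≤ Multiset.card (cub t).roots := Multiset.toFinset_card_le _
          _ ≤ (cub t).natDegree := Polynomial.card_roots' _
          _ ≤ 4 := hcub_deg t
    _ = 4 * TP.card := by rw [Finset.sum_const, smul_eq_mul, mul_comm]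
    _ ≤ 4 * P.support.card := by
        apply Nat.mul_le_mul_left
        calc TP.card = (P.roots.filter (fun t => 0 < t)).toFinset.card := by
              rw [hTP, Multiset.toFinset_filter]
          _ ≤ Multiset.card (P.roots.filter (fun t => 0 < t)) := Multiset.toFinset_card_le _
          _ ≤ P.support.card := OsculationRankOne.card_roots_filter_pos_le_card_support P

/-! ### Vieta signs for the non-monic quartic -/

/-- A positive root of `a₄b⁴ + a₃b³ + a₂b² + a₁b + a₀` (`a₄ ≠ 0`) forces one of `a₃a₄, a₂a₄, a₁a₄, a₀a₄` to be negative. [folklore] -/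
theorem sign_of_pos_root4n {a₄ a₃ a₂ a₁ a₀ b₀ : ℝ} (ha₄ : a₄ ≠ 0) (hb₀ : 0 < b₀)
    (hroot : a₄ * b₀ ^ 4 + a₃ * b₀ ^ 3 + a₂ * b₀ ^ 2 + a₁ * b₀ + a₀ = 0) :
    a₃ * a₄ < 0 ∨ a₂ * a₄ < 0 ∨ a₁ * a₄ < 0 ∨ a₀ * a₄ < 0 := by
  by_contra h
  push Not at h
  obtain ⟨h3, h2, h1, h0⟩ := h
  have hsq : 0 < a₄ * a₄ := mul_self_pos.2 ha₄
  have hb4 : 0 < b₀ ^ 4 := pow_pos hb₀ 4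
  have : a₄ * (a₄ * b₀ ^ 4 + a₃ * b₀ ^ 3 + a₂ * b₀ ^ 2 + a₁ * b₀ + a₀) = 0 := by rw [hroot, mul_zero]
  nlinarith [mul_nonneg h3 (pow_pos hb₀ 3).le, mul_nonneg h2 (sq_nonneg b₀), mul_nonneg h1 hb₀.le, mul_pos hsq hb4]

/-- A negative `aₖa₄` of a real-rooted non-monic quartic forces a positive root (Vieta by four evaluations). [folklore] -/
theorem exists_pos_root_of_sign4n {a₄ a₃ a₂ a₁ a₀ : ℝ} (ha₄ : a₄ ≠ 0)
    (hreal : ∃ μ₁ μ₂ μ₃ μ₄ : ℝ, ∀ b : ℝ,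
      a₄ * b ^ 4 + a₃ * b ^ 3 + a₂ * b ^ 2 + a₁ * b + a₀ = a₄ * ((b - μ₁) * (b - μ₂) * (b - μ₃) * (b - μ₄)))
    (hsign : a₃ * a₄ < 0 ∨ a₂ * a₄ < 0 ∨ a₁ * a₄ < 0 ∨ a₀ * a₄ < 0) :
    ∃ b : ℝ, 0 < b ∧ a₄ * b ^ 4 + a₃ * b ^ 3 + a₂ * b ^ 2 + a₁ * b + a₀ = 0 := by
  obtain ⟨μ₁, μ₂, μ₃, μ₄, hμ⟩ := hreal
  have e0 := hμ 0
  have e1 := hμ 1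
  have em1 := hμ (-1)
  have e2 := hμ 2
  have v1 : a₃ = -a₄ * (μ₁ + μ₂ + μ₃ + μ₄) := by
    linear_combination (1 / 2) * e0 - (1 / 2) * e1 - (1 / 6) * em1 + (1 / 6) * e2
  have v2 : a₂ = a₄ * (μ₁ * μ₂ + μ₁ * μ₃ + μ₁ * μ₄ + μ₂ * μ₃ + μ₂ * μ₄ + μ₃ * μ₄) := by
    linear_combination -e0 + (1 / 2) * e1 + (1 / 2) * em1
  have v3 : a₁ = -a₄ * (μ₁ * μ₂ * μ₃ + μ₁ * μ₂ * μ₄ + μ₁ * μ₃ * μ₄ + μ₂ * μ₃ * μ₄) := by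
    linear_combination -(1 / 2) * e0 + e1 - (1 / 3) * em1 - (1 / 6) * e2
  have v4 : a₀ = a₄ * (μ₁ * μ₂ * μ₃ * μ₄) := by linear_combination e0
  by_cases h1 : 0 < μ₁
  · exact ⟨μ₁, h1, by rw [hμ]; ring⟩
  by_cases h2 : 0 < μ₂
  · exact ⟨μ₂, h2, by rw [hμ]; ring⟩
  by_cases h3 : 0 < μ₃
  · exact ⟨μ₃, h3, by rw [hμ]; ring⟩
  by_cases h4 : 0 < μ₄
  · exact ⟨μ₄, h4, by rw [hμ]; ring⟩
  push Not at h1 h2 h3 h4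
  exfalso
  have hsq : 0 < a₄ * a₄ := mul_self_pos.2 ha₄
  have p12 := mul_nonneg_of_nonpos_of_nonpos h1 h2
  have p13 := mul_nonneg_of_nonpos_of_nonpos h1 h3
  have p23 := mul_nonneg_of_nonpos_of_nonpos h2 h3
  have p34 := mul_nonneg_of_nonpos_of_nonpos h3 h4
  have s1 : 0 ≤ -(μ₁ + μ₂ + μ₃ + μ₄) := by linarith
  have s2 : 0 ≤ μ₁ * μ₂ + μ₁ * μ₃ + μ₁ * μ₄ + μ₂ * μ₃ + μ₂ * μ₄ + μ₃ * μ₄ := by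
    nlinarith [mul_nonneg_of_nonpos_of_nonpos h1 h4, mul_nonneg_of_nonpos_of_nonpos h2 h4]
  have s3 : 0 ≤ -(μ₁ * μ₂ * μ₃ + μ₁ * μ₂ * μ₄ + μ₁ * μ₃ * μ₄ + μ₂ * μ₃ * μ₄) := by
    nlinarith [mul_nonpos_of_nonneg_of_nonpos p12 h3, mul_nonpos_of_nonneg_of_nonpos p12 h4,
      mul_nonpos_of_nonneg_of_nonpos p13 h4, mul_nonpos_of_nonneg_of_nonpos p23 h4]
  have s4 : 0 ≤ μ₁ * μ₂ * μ₃ * μ₄ := by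
    have : μ₁ * μ₂ * μ₃ * μ₄ = (μ₁ * μ₂) * (μ₃ * μ₄) := by ring
    rw [this]; exact mul_nonneg p12 p34
  have t1 : 0 ≤ a₃ * a₄ := by
    have : a₃ * a₄ = (a₄ * a₄) * (-(μ₁ + μ₂ + μ₃ + μ₄)) := by rw [v1]; ring
    rw [this]; exact mul_nonneg hsq.le s1
  have t2 : 0 ≤ a₂ * a₄ := by
    have : a₂ * a₄ = (a₄ * a₄) * (μ₁ * μ₂ + μ₁ * μ₃ + μ₁ * μ₄ + μ₂ * μ₃ + μ₂ * μ₄ + μ₃ * μ₄) := by rw [v2]; ring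
    rw [this]; exact mul_nonneg hsq.le s2
  have t3 : 0 ≤ a₁ * a₄ := by
    have : a₁ * a₄ = (a₄ * a₄) * (-(μ₁ * μ₂ * μ₃ + μ₁ * μ₂ * μ₄ + μ₁ * μ₃ * μ₄ + μ₂ * μ₃ * μ₄)) := by rw [v3]; ring
    rw [this]; exact mul_nonneg hsq.le s3
  have t4 : 0 ≤ a₀ * a₄ := by
    have : a₀ * a₄ = (a₄ * a₄) * (μ₁ * μ₂ * μ₃ * μ₄) := by rw [v4]; ring
    rw [this]; exact mul_nonneg hsq.le s4
  rcases hsign with h | h | h | h <;> linarith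

end OsculationCuspQuartic

end Summit.ValiantsHypothesis.ValiantsHypothesis.Theorems.LacunarySymmetroidMatrixDescartes
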